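/-
Copyright: harness tree, Literature layer (sorry-free). b2b-lace enum1-g52 (ENUMERATION SHARD A gen 52),
node KU-SEP-SEED-K2: the PRODUCT-ROW twisted SEEDCERT kernel evaluator (computable layer).
-/
import Literature.Probability.FitznerVanDerHofstad2017.SrwTwistSeedCertKernel
import HarnessLib

/-!
# Product-row twisted SEEDCERT kernel evaluator (computable layer)

The twisted SEEDCERT kernel of `SrwTwistSeedCertKernel` certifies the row object of ONE folded Bessel
row raised to the `D`-th power (the weight-`1` axis rows).  The weighted slices of the bubble
decomposition (`SrwTwistProductWeight`, `SrwTwistCosPowRow`, `SrwTwistProductSliceBudget`) need the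
PRODUCT ROW OBJECTS

  `R_{n'}(a) = (1/n'!) (∫_0^∞ τ^{n'} e^{-τ} Re ∏_{μ<D} Ψ_{a_μ}(τ/D) dτ) / (2π)^D`,
  `Ψ_a(v) = Σ_{j≤J} ε_j (2^{-a} Σ_{s≤a} C(a,s) I_{jm-(2s-a)}(v)) · 2π i^j q_j`

of a cos-power exponent vector `a : Fin D → ℕ` (per coordinate the finite Bessel row of `cos^{a_μ}`
twisted by `e^{-ijm·}`, literal weights `q_j = Q_j/qden`).  Only the multiset of `a` matters, so a
certificate carries a CLASS LIST `[(a_0,p_0), (a_1,p_1), …]` (exponent `a_r` with multiplicity `p_r`,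
`Σ_r p_r = D`, `Σ_r p_r a_r` even) and the kernel evaluates `∏_r (·)^{p_r}`.

This module is the computable layer, generalising `SrwTwistSeedCertKernel` from one row to a product
of powers of class rows:
* `gzMul2` — the parity-PAIR Gaussian product with exact division: a class series has real parts on
  exponents `≡ ρ` and imaginary parts on exponents `≡ σ (mod 2)` (`ρ = a mod 2`, `σ = (a+m) mod 2`);
  the product of two such series needs four half-shifts `⌊(ρ₁+ρ₂)/2⌋, ⌊(σ₁+σ₂)/2⌋, ⌊(ρ₁+σ₂)/2⌋,
  ⌊(σ₁+ρ₂)/2⌋` (`gzMulP`); `gzPow2` = binary powering tracking the parities of the partial powers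
  (`rhoP`, `sigP`); `gzProd` = the fold over the class list;
* `gzRow2` — the class row `Θ_1^{(a)}`: hat rows at the orders `|jm + a - 2s|` (`cosOrd`) with the
  weights `ε_j |Q_j| C(a,s)` and the sign of `i^j Q_j`;
* the `[T,∞)` lists: `gzP2` (the scaled main polynomial `2^S qden 2^a P_a(w)` of a class),
  `gzWProd` (the product `∏_r P_{a_r}^{p_r}` by `gzPowW`/`gzMulW`); the error majorant lists are those
  of the single-row kernel (`majBase`, `powN`);
* `PrCert` (extends `TwCert` by the class list) and the Boolean check `PrCert.checkP` — the single-row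
  parameter / final checks are reused through `PrCert.toTwCert`, the Poisson layer divides the reused
  Horner sums `PqT`/`UqT` by `2^{Σ p_r a_r}`, the tail layer divides by `(2^S qden)^D 2^{Σ p_r a_r}`.
Semantics and soundness: `SrwTwistProdCertSemantics`, `SrwTwistProdCertSound`.
[cite: FitznerVanDerHofstad2016NoBLE, §5.1.1 (5.2)–(5.5) pp. 1089–1090]
-/

set_option Elab.async false

namespace Literature.Probability.FitznerVanDerHofstad2017.SeedCert

open Finset

/-! ### Parity-pair Gaussian products with exact division -/

/-- **The parity-pair Gaussian product with exact division.** For `X = (A,B)`, `Y = (C,D)` holding the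
real/imaginary half-lists of two series (entry `k` ↔ exponent `2k+ρ` resp. `2k+σ`), the four partial
products are shifted by `eRR, eII, eRI, eIR ∈ {0,1}` half-steps: real part `z^{eRR} AC - z^{eII} BD`,
imaginary part `z^{eRI} AD + z^{eIR} BC` (`z = s²`); truncated to `L`, normalised, divided by `Mf`.
[cite: FitznerVanDerHofstad2016NoBLE, §5.1.1 (5.4)–(5.5) pp. 1089–1090] -/
def gzMul2 (eRR eII eRI eIR Mf L : ℕ) (X Y : GZ) : GZ :=
  let re := subPN (shiftPN eRR L (mulPN X.1 Y.1 L)) (shiftPN eII L (mulPN X.2 Y.2 L))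
  let im := addPN (shiftPN eRI L (mulPN X.1 Y.2 L)) (shiftPN eIR L (mulPN X.2 Y.1 L))
  (forcePN (divPN Mf (normPN re)), forcePN (divPN Mf (normPN im)))

/-- `gzMul2` with the shifts of the parity pairs `(ρ₁,σ₁)`, `(ρ₂,σ₂)` of the operands.
[cite: FitznerVanDerHofstad2016NoBLE, §5.1.1 (5.4)–(5.5) pp. 1089–1090] -/
def gzMulP (Mf L ρ₁ σ₁ ρ₂ σ₂ : ℕ) (X Y : GZ) : GZ :=
  gzMul2 ((ρ₁ + ρ₂) / 2) ((σ₁ + σ₂) / 2) ((ρ₁ + σ₂) / 2) ((σ₁ + ρ₂) / 2) Mf L X Y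

/-- Real-part parity of the `p`-th power of a series with real-part parity `ρ`. [cite: FitznerVanDerHofstad2016NoBLE, §5.1.1 (5.4)–(5.5) pp. 1089–1090] -/
def rhoP (ρ p : ℕ) : ℕ := (p * ρ) % 2

/-- Imaginary-part parity of the `p`-th power of a series with parity pair `(ρ,σ)`. [cite: FitznerVanDerHofstad2016NoBLE, §5.1.1 (5.4)–(5.5) pp. 1089–1090] -/
def sigP (ρ σ p : ℕ) : ℕ := (p * ρ + ρ + σ) % 2

/-- Binary powering with fuel for a base of parity pair `(ρ,σ)`: `gzPow2Aux ρ σ Mf L R fuel p = R^p`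
(`1 ≤ p ≤ fuel + 1`). [cite: FitznerVanDerHofstad2016NoBLE, §5.1.1 (5.4)–(5.5) pp. 1089–1090] -/
def gzPow2Aux (ρ σ Mf L : ℕ) (R : GZ) : ℕ → ℕ → GZ
  | 0, _ => R
  | fuel + 1, p =>
      bif Nat.ble p 1 then R
      else bif p % 2 == 0 then
        let H := gzPow2Aux ρ σ Mf L R fuel (p / 2)
        gzMulP Mf L (rhoP ρ (p / 2)) (sigP ρ σ (p / 2)) (rhoP ρ (p / 2)) (sigP ρ σ (p / 2)) H H
      else gzMulP Mf L ρ σ (rhoP ρ (p - 1)) (sigP ρ σ (p - 1)) R (gzPow2Aux ρ σ Mf L R fuel (p - 1))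

/-- `R^p` by binary powering (see `gzPow2Aux`). [cite: FitznerVanDerHofstad2016NoBLE, §5.1.1 (5.4)–(5.5) pp. 1089–1090] -/
def gzPow2 (ρ σ Mf L : ℕ) (R : GZ) (p : ℕ) : GZ := gzPow2Aux ρ σ Mf L R p p

/-! ### The class rows -/

/-- The Bessel order `|jm + a - 2s|` of the `(j,s)` term of the `cos^a` class row.
[cite: FitznerVanDerHofstad2016NoBLE, §5.1.1 (5.4)–(5.5) pp. 1089–1090] -/
def cosOrd (m a j s : ℕ) : ℕ := if 2 * s ≤ j * m + a then j * m + a - 2 * s else 2 * s - (j * m + a)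

/-- The unsigned weight `ε_j |Q_j| C(a,s)` of the `(j,s)` term. [cite: FitznerVanDerHofstad2016NoBLE, §5.1.1 (5.4)–(5.5) pp. 1089–1090] -/
def cosW (a : ℕ) (Q : ℕ → ℤ) (j s : ℕ) : ℕ := (if j = 0 then 1 else 2) * (Q j).natAbs * a.choose s

/-- The signed contribution of the `(j,s)` term of the `cos^a` class row (order `cosOrd m a j s`, weight
`cosW a Q j s`, unit `i^j`, sign of `Q_j`) to the parity-split row: real half-list (offset `ρ`) for even
`j`, imaginary half-list (offset `σ`) for odd `j`. [cite: FitznerVanDerHofstad2016NoBLE, §5.1.1 (5.4)–(5.5) pp. 1089–1090] -/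
def rowTermGZ2 (Mf K ρ σ m a : ℕ) (Q : ℕ → ℤ) (j s : ℕ) : GZ :=
  let b := cosOrd m a j s
  let cabs := cosW a Q j s
  let neg : Bool := xor (decide (Q j < 0)) (decide (2 ≤ j % 4))
  let z := List.replicate (K + 1) 0
  if j % 2 = 0 then
    let t := rowTerm Mf K b ((b - ρ) / 2) cabs
    (bif neg then (z, t) else (t, z), (z, z))
  else
    let t := rowTerm Mf K b ((b - σ) / 2) cabs
    ((z, z), bif neg then (z, t) else (t, z))

/-- **The `cos^a` class row** `Θ_1^{(a)}` (flattened double sum over `j ≤ J`, `s ≤ a`; normalised):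
real entry `k` = `Mf · Re φ_a(2k+ρ)/(2k+ρ)!`, imaginary entry `k` = `Mf · Im φ_a(2k+σ)/(2k+σ)!`.
[cite: FitznerVanDerHofstad2016NoBLE, §5.1.1 (5.4)–(5.5) pp. 1089–1090] -/
def gzRow2 (Mf K ρ σ m a J : ℕ) (Q : ℕ → ℤ) : GZ :=
  let z := zeroPN (K + 1)
  let s := gzSum (fun i => rowTermGZ2 Mf K ρ σ m a Q (i / (a + 1)) (i % (a + 1))) ((J + 1) * (a + 1)) (z, z)
  (forcePN (normPN s.1), forcePN (normPN s.2))

/-- The power table `(Θ_1^{(a)})^p` of one class. [cite: FitznerVanDerHofstad2016NoBLE, §5.1.1 (5.4)–(5.5) pp. 1089–1090] -/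
def gzClass (Mf K m J : ℕ) (Q : ℕ → ℤ) (a p : ℕ) : GZ :=
  gzPow2 (a % 2) ((a + m) % 2) Mf (K + 1) (gzRow2 Mf K (a % 2) ((a + m) % 2) m a J Q) p

/-- The fold of the class tables: `(acc · ∏ classes, parities)`. [cite: FitznerVanDerHofstad2016NoBLE, §5.1.1 (5.4)–(5.5) pp. 1089–1090] -/
def gzProdAux (Mf K m J : ℕ) (Q : ℕ → ℤ) : GZ → ℕ → ℕ → List (ℕ × ℕ) → GZ × ℕ × ℕ
  | acc, ρ, σ, [] => (acc, ρ, σ)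
  | acc, ρ, σ, (a, p) :: t =>
      let ρ' := rhoP (a % 2) p
      let σ' := sigP (a % 2) ((a + m) % 2) p
      gzProdAux Mf K m J Q (gzMulP Mf (K + 1) ρ σ ρ' σ' acc (gzClass Mf K m J Q a p))
        ((ρ + ρ') % 2) ((ρ + σ') % 2) t

/-- **The product table** `∏_r (Θ_1^{(a_r)})^{p_r}` with its parity pair (empty list: a dummy).
[cite: FitznerVanDerHofstad2016NoBLE, §5.1.1 (5.4)–(5.5) pp. 1089–1090] -/
def gzProd (Mf K m J : ℕ) (Q : ℕ → ℤ) : List (ℕ × ℕ) → GZ × ℕ × ℕ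
  | [] => ((zeroPN (K + 1), zeroPN (K + 1)), 0, 0)
  | (a, p) :: t => gzProdAux Mf K m J Q (gzClass Mf K m J Q a p) (rhoP (a % 2) p)
      (sigP (a % 2) ((a + m) % 2) p) t

/-! ### The `[T,∞)` layer: class main polynomials and their product -/

/-- The signed, scaled contribution `ε_j Q_j C(a,s) · 2^S Mid_b` (`b = cosOrd m a j s`) of the `(j,s)`
term to `2^S qden 2^a P_a(w)`. [cite: FitznerVanDerHofstad2016NoBLE, §5.1.1 (5.4)–(5.5) pp. 1089–1090] -/
def wTermGZ2 (Jb S ℓ m a : ℕ) (Q : ℕ → ℤ) (j s : ℕ) : GZ :=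
  let b := cosOrd m a j s
  let cabs := cosW a Q j s
  let neg : Bool := xor (decide (Q j < 0)) (decide (2 ≤ j % 4))
  let base := smulPN cabs (pnOfZ (midListZ b Jb S ℓ))
  let t := bif neg then negPN base else base
  let z := zeroPN ℓ
  if j % 2 = 0 then (t, z) else (z, t)

/-- **`2^S · qden · 2^a · P_a(w)`** as a Gaussian coefficient list of length `ℓ` (normalised).
[cite: FitznerVanDerHofstad2016NoBLE, §5.1.1 (5.4)–(5.5) pp. 1089–1090] -/
def gzP2 (Jb S ℓ m a J : ℕ) (Q : ℕ → ℤ) : GZ :=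
  let z := zeroPN ℓ
  let s := gzSum (fun i => wTermGZ2 Jb S ℓ m a Q (i / (a + 1)) (i % (a + 1))) ((J + 1) * (a + 1)) (z, z)
  (forcePN (normPN s.1), forcePN (normPN s.2))

/-- The fold of the class polynomial powers: `(acc · ∏ P_{a}^{p}, length)`.
[cite: FitznerVanDerHofstad2016NoBLE, §5.1.1 (5.4)–(5.5) pp. 1089–1090] -/
def gzWProdAux (Jb S ℓ m J : ℕ) (Q : ℕ → ℤ) : GZ → ℕ → List (ℕ × ℕ) → GZ × ℕ
  | acc, len, [] => (acc, len)
  | acc, len, (a, p) :: t =>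
      let Y := gzPowW ℓ (gzP2 Jb S ℓ m a J Q) p
      let len' := len + p * (ℓ - 1)
      gzWProdAux Jb S ℓ m J Q (gzMulW len' acc Y) len' t

/-- **`∏_r (2^S qden 2^{a_r} P_{a_r}(w))^{p_r}`** as a Gaussian coefficient list (length `D(ℓ-1)+1`).
[cite: FitznerVanDerHofstad2016NoBLE, §5.1.1 (5.4)–(5.5) pp. 1089–1090] -/
def gzWProd (Jb S ℓ m J : ℕ) (Q : ℕ → ℤ) : List (ℕ × ℕ) → GZ × ℕ
  | [] => ((zeroPN 1, zeroPN 1), 1)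
  | (a, p) :: t => gzWProdAux Jb S ℓ m J Q (gzPowW ℓ (gzP2 Jb S ℓ m a J Q) p) (p * (ℓ - 1) + 1) t

/-! ### Certificates -/

/-- The data of a PRODUCT-ROW twisted seed certificate: the single-row data `TwCert` (orders `j·m`,
literal weights `Q j / qden`, cut-off `T = t²`, bracket order `Jb`, cut point `s₀`, half-table length
`K+1`, truncations `M n`, bracket constants `eps`, dyadic scale `S`, `nexp`, `sLo ≤ √(2π) ≤ sHi`, the
majorant constants `alpha`, `rho`, the target intervals and the intermediate brackets) EXTENDED by the
class list `cls = [(a_0,p_0), …]` (cos-power exponent, multiplicity).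
[cite: FitznerVanDerHofstad2016NoBLE, §5.1.1 (5.4)–(5.5) pp. 1089–1090] -/
structure PrCert extends TwCert where
  cls : List (ℕ × ℕ)

/-- Unrolling of a class list: `[(a_0,p_0), (a_1,p_1), …] ↦ [a_0 × p_0, a_1 × p_1, …]`.
[cite: FitznerVanDerHofstad2016NoBLE, §5.1.1 (5.4)–(5.5) pp. 1089–1090] -/
def unroll : List (ℕ × ℕ) → List ℕ
  | [] => []
  | (a, p) :: t => List.replicate p a ++ unroll t

namespace PrCert

variable (c : PrCert) (D : ℕ)

/-- The exponent vector as a list of length `Σ p_r`. [cite: FitznerVanDerHofstad2016NoBLE, §5.1.1 (5.4)–(5.5) pp. 1089–1090] -/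
def aList : List ℕ := unroll c.cls

/-- `Σ_r p_r` (must be `D`). [cite: FitznerVanDerHofstad2016NoBLE, §5.1.1 (5.4)–(5.5) pp. 1089–1090] -/
def psum : ℕ := (c.cls.map fun ap => ap.2).sum

/-- `A = Σ_r p_r a_r` (must be even). [cite: FitznerVanDerHofstad2016NoBLE, §5.1.1 (5.4)–(5.5) pp. 1089–1090] -/
def asum : ℕ := (c.cls.map fun ap => ap.2 * ap.1).sum

/-- `max_r a_r`. [cite: FitznerVanDerHofstad2016NoBLE, §5.1.1 (5.4)–(5.5) pp. 1089–1090] -/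
def amax : ℕ := maxN (c.cls.map fun ap => ap.1)

/-- The largest Bessel order `J·m + max a`. [cite: FitznerVanDerHofstad2016NoBLE, §5.1.1 (5.4)–(5.5) pp. 1089–1090] -/
def maxOrd : ℕ := c.J * c.m + c.amax

/-- The product table with its parity flags. [cite: FitznerVanDerHofstad2016NoBLE, §5.1.1 (5.4)–(5.5) pp. 1089–1090] -/
def tableP : GZ × ℕ × ℕ := gzProd (prodRange 0 c.Mh) c.K c.m c.J c.Q c.cls

/-- `2^A`, the extra scale of the product table and of the product polynomial. [cite: FitznerVanDerHofstad2016NoBLE, §5.1.1 (5.4)–(5.5) pp. 1089–1090] -/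
def twoA : ℚ := (2 : ℚ) ^ c.asum

/-- `P_n` of the product table: the single-row Horner value divided by `2^A`. [cite: FitznerVanDerHofstad2016NoBLE, §5.1.1 (5.4)–(5.5) pp. 1089–1090] -/
def PqP (re : List ℕ × List ℕ) (n : ℕ) : ℚ := c.toTwCert.PqT D re n / c.twoA

/-- `U_n` of the product table: the single-row Horner value divided by `2^A`. [cite: FitznerVanDerHofstad2016NoBLE, §5.1.1 (5.4)–(5.5) pp. 1089–1090] -/
def UqP (re : List ℕ × List ℕ) (n : ℕ) : ℚ := c.toTwCert.UqT D re n / c.twoA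

/-- Length of the `w`-coefficient lists of the class polynomials. [cite: FitznerVanDerHofstad2016NoBLE, §5.1.1 (5.4)–(5.5) pp. 1089–1090] -/
def lw2 : ℕ := blen c.maxOrd c.Jb

/-- The real part `(pos, neg)` of `∏_r (2^S qden 2^{a_r} P_{a_r}(w))^{p_r}`. [cite: FitznerVanDerHofstad2016NoBLE, §5.1.1 (5.4)–(5.5) pp. 1089–1090] -/
def powRe2 : List ℕ × List ℕ := ((gzWProd c.Jb c.S c.lw2 c.m c.J c.Q c.cls).1).1

/-- The scale `(2^S qden)^D 2^A` of `powRe2`. [cite: FitznerVanDerHofstad2016NoBLE, §5.1.1 (5.4)–(5.5) pp. 1089–1090] -/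
def scaleP2 : ℚ := ((2 : ℚ) ^ c.S * (c.qden : ℚ)) ^ D * c.twoA

/-- `IM_n = ∫_T^∞ u^{n-1-D/2} Re ∏_r P_{a_r}(1/u)^{p_r} du` (exact, termwise). [cite: FitznerVanDerHofstad2016NoBLE, §5.1.1 (5.4)–(5.5) pp. 1089–1090] -/
def IM2 (pr : List ℕ × List ℕ) (n : ℕ) : ℚ := tailInt c.t pr (D - 2 * n) / c.scaleP2 D

/-- `Σ_{j ≤ J, s ≤ a} ε_j |Q_j| C(a,s) eps (cosOrd m a j s)` (numerator of `2^a Σ ε_j |q_j| 2^{-a} Σ_s C(a,s) ε_b`).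
[cite: FitznerVanDerHofstad2016NoBLE, §5.1.1 (5.4)–(5.5) pp. 1089–1090] -/
def wepsSum2 (a : ℕ) : ℚ :=
  ((List.range ((c.J + 1) * (a + 1))).map fun i =>
    (cosW a c.Q (i / (a + 1)) (i % (a + 1)) : ℚ) * c.eps (cosOrd c.m a (i / (a + 1)) (i % (a + 1)))).sum

/-- The extra parameter checks of a product certificate: non-empty class list of positive multiplicities
summing to `D`, `A` even, every order `b ≤ Jm + max a` with a valid nonnegative bracket constant and dyadic
main coefficients, and per class `Σ_{j,s} ε_j |Q_j| C(a,s) ε_b ≤ ρ · qden · 2^a`. (Kernel cost: seconds.)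
[cite: FitznerVanDerHofstad2016NoBLE, §5.1.1 (5.4)–(5.5) pp. 1089–1090] -/
def extraOKP : Bool :=
  decide (c.cls ≠ []) && c.cls.all (fun ap => decide (1 ≤ ap.2)) && decide (c.psum = D) &&
  decide (c.asum % 2 = 0) &&
  (List.range (c.maxOrd + 1)).all (fun b =>
    decide (0 ≤ c.eps b) && decide (epsBoundQ b c.Jb c.s0 c.t c.sHi c.nexp ≤ c.eps b) &&
    (midList b c.Jb).all (dyadicOK c.S)) &&
  c.cls.all (fun ap => decide (c.wepsSum2 ap.1 ≤ c.rho * c.qden * (2 : ℚ) ^ ap.1))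

/-- All parameter checks: the single-row checks (`TwCert.paramsOKT`) and the extra product checks.
[cite: FitznerVanDerHofstad2016NoBLE, §5.1.1 (5.4)–(5.5) pp. 1089–1090] -/
def paramsOKP : Bool := c.toTwCert.paramsOKT D && c.extraOKP D

/-- **Poisson layer check**: the product table carries real parity `0` and the exact `P_n`, `U_n` lie
in the brackets. (Kernel cost: the table.) [cite: FitznerVanDerHofstad2016NoBLE, §5.1.1 (5.4)–(5.5) pp. 1089–1090] -/
def poissonCheckP : Bool :=
  let tp := c.tableP
  let re := tp.1.1
  decide (tp.2.1 = 0) &&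
  (List.range 4).all fun i =>
    decide (c.pLo (i + 1) ≤ c.PqP D re (i + 1)) && decide (c.PqP D re (i + 1) ≤ c.pHi (i + 1)) &&
    decide (c.uLo (i + 1) ≤ c.UqP D re (i + 1)) && decide (c.UqP D re (i + 1) ≤ c.uHi (i + 1))

/-- **Tail layer check, main part**: `imLo n ≤ IM_n ≤ imHi n` for the kernel-evaluated product polynomial.
(Kernel cost: the products `∏_r P_{a_r}^{p_r}`; its own `decide` so that the kernel's evaluation cache of this
check and of `tailCheckIB` stay separate.) [cite: FitznerVanDerHofstad2016NoBLE, §5.1.1 (5.4)–(5.5) pp. 1089–1090] -/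
def tailCheckIM : Bool :=
  let pr := c.powRe2
  (List.range 4).all fun i =>
    decide (c.imLo (i + 1) ≤ c.IM2 D pr (i + 1)) && decide (c.IM2 D pr (i + 1) ≤ c.imHi (i + 1))

/-- **Tail layer check, error majorant part**: `IB_n ≤ ibHi n` (the single-row majorant lists, reused).
[cite: FitznerVanDerHofstad2016NoBLE, §5.1.1 (5.4)–(5.5) pp. 1089–1090] -/
def tailCheckIB : Bool :=
  let gg := (powN c.lg c.g2 D, powN c.lg c.g1 D)
  (List.range 4).all fun i => decide (c.toTwCert.IB D gg (i + 1) ≤ c.ibHi (i + 1))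

/-- **Tail layer check** (the conjunction of `tailCheckIM` and `tailCheckIB`).
[cite: FitznerVanDerHofstad2016NoBLE, §5.1.1 (5.4)–(5.5) pp. 1089–1090] -/
def tailCheckP : Bool := c.tailCheckIM D && c.tailCheckIB D

/-- **The certificate check** (the conjunction; an instance file proves the conjuncts as separate
`decide +kernel` theorems: `paramsOKP`, `toTwCert.finalCheckT`, `poissonCheckP`, `tailCheckIM`, `tailCheckIB`). [cite: FitznerVanDerHofstad2016NoBLE, §5.1.1 (5.4)–(5.5) pp. 1089–1090] -/
def checkP : Bool :=
  c.paramsOKP D && c.toTwCert.finalCheckT D && c.poissonCheckP D && c.tailCheckP D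

end PrCert

end Literature.Probability.FitznerVanDerHofstad2017.SeedCert
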